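import Literature.Analysis.FluidPDE.FluidComputer.TubeTable
import HarnessLib

/-!
# Kernel run of the tube checker, chunks 6 … 11 (steps 300 … 599) (bp3 gen 13)

HONEST FRAMING: low prior, high value-of-information experiment on Tao's machine paradigm; NOT a
claim that NS blows up.

Kernel evaluations (`decide +kernel`; no `native_decide`, no extra axioms) of the tube checker
`runTube` of `TubeCheck.lean` (dyadic interval arithmetic `DI` at `P = 60`, `12` Taylor terms,
cube radius `Rt`, read-out level `CLt`) on the chunks `cT 6 … cT 11` of the schedule of
`TubeTable.lean`, each from the recorded boundary state `sT i` to `sT (i+1)` (≈ 0.6 s of kernel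
time per step).
-/

namespace Literature.Analysis.FluidPDE.FluidComputer

namespace TubeTable

open ThresholdLevelTable

set_option maxHeartbeats 10000000 in
set_option maxRecDepth 200000 in
/-- Chunk 6 of the tube run (steps 300 … 349, `h = 2^-11`). [folklore] -/
theorem run_6 : runTube 60 12 GIt CLt Rt (sT 6) (cT 6) = some (sT (6 + 1)) := by
  decide +kernel

set_option maxHeartbeats 10000000 in
set_option maxRecDepth 200000 in
/-- Chunk 7 of the tube run (steps 350 … 399, `h = 2^-11`). [folklore] -/
theorem run_7 : runTube 60 12 GIt CLt Rt (sT 7) (cT 7) = some (sT (7 + 1)) := by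
  decide +kernel

set_option maxHeartbeats 10000000 in
set_option maxRecDepth 200000 in
/-- Chunk 8 of the tube run (steps 400 … 449, `h = 2^-11`). [folklore] -/
theorem run_8 : runTube 60 12 GIt CLt Rt (sT 8) (cT 8) = some (sT (8 + 1)) := by
  decide +kernel

set_option maxHeartbeats 10000000 in
set_option maxRecDepth 200000 in
/-- Chunk 9 of the tube run (steps 450 … 499, `h = 2^-11`). [folklore] -/
theorem run_9 : runTube 60 12 GIt CLt Rt (sT 9) (cT 9) = some (sT (9 + 1)) := by
  decide +kernel

set_option maxHeartbeats 10000000 in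
set_option maxRecDepth 200000 in
/-- Chunk 10 of the tube run (steps 500 … 549, `h = 2^-11`). [folklore] -/
theorem run_10 : runTube 60 12 GIt CLt Rt (sT 10) (cT 10) = some (sT (10 + 1)) := by
  decide +kernel

set_option maxHeartbeats 10000000 in
set_option maxRecDepth 200000 in
/-- Chunk 11 of the tube run (steps 550 … 599, `h = 2^-11`). [folklore] -/
theorem run_11 : runTube 60 12 GIt CLt Rt (sT 11) (cT 11) = some (sT (11 + 1)) := by
  decide +kernel

end TubeTable

end Literature.Analysis.FluidPDE.FluidComputer
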